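import Summits.QuantumFields.YangMills.Theorems.BalabanUVNodesN19SingleModeMomentFirstOrderLadder

/-!
# YM-DAG node N19 (= NE7 proper) — ONE LADDER WITH MASS FOR ALL FREQUENCIES
# (module 144's Jackson ladder with Taylor steps and coefficient mass, the top approximant `A_J` chosen BEFORE the frequency)

Cell `pub-ymgap`, HUMAN RULING D-0062 (Track A) ∕ D-0149 (work-bound push), R141 (C) wider-strategy seat `pub-ymgap-dag-n19-e` (strategy
s3 = ALTERNATIVE CURRENCY), generation g33, module 7 (lineage module 154).  Route `Summits/QuantumFields/YangMills/Theses/BalabanUVNodes.lean`,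
cluster item K3⁸ «SpineGivenEndpointR13SepCoPHV» (stmt-QuantumFields-27366); filed `--supports` that item `--as helper` (it proves no registered
stub).  COUNT-NEUTRAL: [folklore]∕[bookkeeping] over Mathlib and the lineage BY NAME — module 143 `…N19SingleModeMomentFirstOrder`
(`exists_pair_near_cexp_sum_taylor_mass`), module 144 `…N19SingleModeMomentFirstOrderLadder` (`level_mass_le`), module 128 (`exists_additiveJackson_mass`),
module 127 (`mass_sub_le`, `mass_C_le`), module 119 (`abs_l1Norm_sub_half_le`); no laws, no scheme object, no Theses import; NOT a discharge claim.

ROLE IN THE LINEAGE.  The MOMENT-CURRENCY face of the smoothed-link first-order law (modules 150–153, degree model: every Lipschitz link of `Σ|x_i|` at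
`d·log³t∕t`) needs the ladder pairs `≈ e^{iω_pA_J}` for ALL the modes `ω_p` of the smoothed link with ONE `A_J` (module 151 §1 did this for the degree)
AND with COEFFICIENT MASS (module 144 did this for one frequency).  This module is module 144 §1 with the quantifiers in the useful order:
`exists_ladder_pairs_near_cexp_additiveJackson_mass_uniform` — ONE `A = A_J` (`mass A ≤ d·2^J·9^{2^J}`, `|Σ|x_i| − A| ≤ dπ∕2^J`) and, for EVERY `ω ≥ 0`,
a pair within `2(J+1)e^{−h}` of `e^{iωA(x)}` on the cube with masses `≤ exp Λ(ω)`,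
`Λ(ω) = (J+1)log 2 + (6πe²ωd + h(J+1))·log(1 + 10ωd) + (3πe²ωd(J+1) + h(2^{J+1} − 1))·log 81` (proof verbatim: only the Taylor orders depend on `ω`).
The sequel (`…N19LipschitzLinksMomentFirstOrder`) sums the pairs over the modes with module 127's mass bookkeeping and multiplies by `(A_N − A_J)`;
`…N19LipschitzLinksMomentBudget` chooses the parameters at budget `L = log r⁻¹` (module 145's `exists_scale_L` ∕ `exists_order_L` ∕ `logmass_le`).

HONEST FRAMING (binding).  Elementary and [folklore]; NO consumer in the DAG today (the seat's own currency map); nothing of Bałaban's instantiated; NE7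
NOT PRINTED, NOT proved; N19 NOT discharged; count-neutral.  One finite `T⁴` programme at fixed `ε`; nothing continuum ∕ `ℝ⁴` ∕ OS ∕ mass-gap ∕ Clay.
0 `def` ∕ 0 `sorry`.
-/

noncomputable section

open Finset Complex
open scoped Real

namespace Summit.QuantumFields.YangMills.Theorems.BalabanUVNodesN19LipschitzLinksMomentLadder

open Summit.QuantumFields.YangMills.Theorems.BalabanUVNodesN19SingleModeMomentFirstOrder (exists_pair_near_cexp_sum_taylor_mass)
open Summit.QuantumFields.YangMills.Theorems.BalabanUVNodesN19SingleModeMomentFirstOrderLadder (level_mass_le)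
open Summit.QuantumFields.YangMills.Theorems.BalabanUVNodesN19SingleModeMomentLadder (exists_additiveJackson_mass)
open Summit.QuantumFields.YangMills.Theorems.BalabanUVNodesN19CoefficientMassPricing
open Summit.QuantumFields.YangMills.Theorems.BalabanUVNodesN19SingleModeL1Norm (abs_l1Norm_sub_half_le)

variable {ι : Type*} [Fintype ι]

/-! ## §1 One ladder with mass for all frequencies [folklore] -/

/-- **ONE LADDER WITH MASS FOR ALL FREQUENCIES.**  For `J : ℕ` and `h ≥ 1` with `(J+1)e^{−h} ≤ ½` there is a real `MvPolynomial` `A` (the additive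
Jackson approximant with `M = 2^J`: `mass A ≤ d·2^J·9^{2^J}`, `|Σ_i|x_i| − A(x)| ≤ dπ∕2^J` on `[−1,1]^ι`, `d = |ι|`) such that for EVERY `ω ≥ 0` there is
a pair `(Cr, Ci)` with masses `≤ exp((J+1)log 2 + (6πe²ωd + h(J+1))log(1 + 10ωd) + (3πe²ωd(J+1) + h(2^{J+1} − 1))log 81)` and
`‖Cr(x) + Ci(x)·i − e^{iωA(x)}‖ ≤ 2(J+1)e^{−h}` on the cube.  Module 144 §1 verbatim with the ladder (`A_l`, increments `B_l`, bounds `R_l`, masses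
`m_B(l)`) chosen before `ω`; only the Taylor orders `⌈e²ωR_l⌉ + h` and the mass exponent depend on `ω`. [folklore] -/
theorem exists_ladder_pairs_near_cexp_additiveJackson_mass_uniform (J h : ℕ) (hh : 1 ≤ h)
    (hJh : ((J : ℝ) + 1) * Real.exp (-(h : ℝ)) ≤ 1 / 2) :
    ∃ A : MvPolynomial ι ℝ, (∑ s ∈ A.support, |A.coeff s|) ≤ Fintype.card ι * (2 ^ J * 9 ^ (2 ^ J)) ∧
      (∀ x : ι → ℝ, (∀ i, x i ∈ Set.Icc (-1 : ℝ) 1) → |(∑ i, |x i|) - MvPolynomial.eval x A| ≤ Fintype.card ι * π / 2 ^ J) ∧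
      ∀ ω : ℝ, 0 ≤ ω → ∃ Cr Ci : MvPolynomial ι ℝ,
        (∑ s ∈ Cr.support, |Cr.coeff s|) ≤ Real.exp (((J : ℝ) + 1) * Real.log 2 +
            (6 * π * Real.exp 2 * (ω * Fintype.card ι) + h * ((J : ℝ) + 1)) * Real.log (1 + 10 * (ω * Fintype.card ι)) +
            (3 * π * Real.exp 2 * (ω * Fintype.card ι) * ((J : ℝ) + 1) + h * (2 ^ (J + 1) - 1)) * Real.log 81) ∧
        (∑ s ∈ Ci.support, |Ci.coeff s|) ≤ Real.exp (((J : ℝ) + 1) * Real.log 2 +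
            (6 * π * Real.exp 2 * (ω * Fintype.card ι) + h * ((J : ℝ) + 1)) * Real.log (1 + 10 * (ω * Fintype.card ι)) +
            (3 * π * Real.exp 2 * (ω * Fintype.card ι) * ((J : ℝ) + 1) + h * (2 ^ (J + 1) - 1)) * Real.log 81) ∧
        ∀ x : ι → ℝ, (∀ i, x i ∈ Set.Icc (-1 : ℝ) 1) →
          ‖((MvPolynomial.eval x Cr : ℝ) : ℂ) + ((MvPolynomial.eval x Ci : ℝ) : ℂ) * I -
              exp (((ω * MvPolynomial.eval x A : ℝ) : ℂ) * I)‖ ≤ 2 * ((J : ℝ) + 1) * Real.exp (-(h : ℝ)) := by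
  set d : ℝ := (Fintype.card ι : ℝ) with hd
  have hd0 : 0 ≤ d := Nat.cast_nonneg _
  have hπ3 : (3 : ℝ) < π := Real.pi_gt_three
  -- the Jackson ladder with masses
  choose A hAmass hAerr using fun l : ℕ => exists_additiveJackson_mass (ι := ι) (M := 2 ^ l) (pow_pos two_pos l)
  obtain ⟨A', hA'0, hA's⟩ : ∃ A' : ℕ → MvPolynomial ι ℝ, A' 0 = MvPolynomial.C (d / 2) ∧ ∀ l, A' (l + 1) = A l :=
    ⟨fun l => if l = 0 then MvPolynomial.C (d / 2) else A (l - 1), if_pos rfl, fun l => by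
      show (if l + 1 = 0 then MvPolynomial.C (d / 2) else A (l + 1 - 1)) = A l
      rw [if_neg (Nat.succ_ne_zero l), Nat.add_sub_cancel]⟩
  obtain ⟨B, hB⟩ : ∃ B : ℕ → MvPolynomial ι ℝ, ∀ l, B l = A l - A' l := ⟨fun l => A l - A' l, fun l => rfl⟩
  obtain ⟨R, hR0', hRs⟩ : ∃ R : ℕ → ℝ, R 0 = d * (1 / 2 + π) ∧ ∀ l, R (l + 1) = 3 * d * π / 2 ^ (l + 1) :=
    ⟨fun l => if l = 0 then d * (1 / 2 + π) else 3 * d * π / 2 ^ l, if_pos rfl, fun l => if_neg (Nat.succ_ne_zero l)⟩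
  obtain ⟨mB, hmB0, hmBs⟩ : ∃ mB : ℕ → ℝ, mB 0 = 10 * d ∧ ∀ l, mB (l + 1) = 2 * d * (2 ^ (l + 1) * 9 ^ (2 ^ (l + 1))) :=
    ⟨fun l => if l = 0 then 10 * d else 2 * d * (2 ^ l * 9 ^ (2 ^ l)), if_pos rfl, fun l => if_neg (Nat.succ_ne_zero l)⟩
  have hR0 : ∀ l, 0 ≤ R l := by
    intro l; cases l with
    | zero => rw [hR0']; positivity
    | succ l => rw [hRs]; positivity
  -- masses of the increments (module 129)
  have hmassB : ∀ l, l < J + 1 → (∑ s ∈ (B l).support, |(B l).coeff s|) ≤ mB l := by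
    intro l _
    rw [hB]
    refine (mass_sub_le _ _).trans ?_
    cases l with
    | zero =>
      rw [hA'0, hmB0]
      have h1 : (∑ s ∈ (A 0).support, |(A 0).coeff s|) ≤ d * 9 := by
        have := hAmass 0; rw [← hd] at this; simpa using this
      have h2 := mass_C_le (ι := ι) (d / 2)
      rw [abs_of_nonneg (by positivity)] at h2
      linarith
    | succ l =>
      rw [hA's, hmBs]
      have h1 := hAmass (l + 1)
      have h2 := hAmass l
      rw [← hd] at h1 h2
      push_cast at h1 h2 ⊢
      have h3 : (2 : ℝ) ^ l * 9 ^ (2 ^ l) ≤ 2 ^ (l + 1) * 9 ^ (2 ^ (l + 1)) :=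
        mul_le_mul (pow_le_pow_right₀ one_le_two (Nat.le_succ l)) (pow_le_pow_right₀ (by norm_num)
          (Nat.pow_le_pow_right two_pos (Nat.le_succ l))) (by positivity) (by positivity)
      have h4 := mul_le_mul_of_nonneg_left h3 hd0
      linarith
  -- cube bounds of the increments (module 139 §2)
  have hBR : ∀ l, l < J + 1 → ∀ x : ι → ℝ, (∀ i, x i ∈ Set.Icc (-1 : ℝ) 1) → |MvPolynomial.eval x (B l)| ≤ R l := by
    intro l _ x hx
    rw [hB, map_sub]
    cases l with
    | zero =>
      rw [hA'0, hR0', MvPolynomial.eval_C]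
      have h1 := hAerr 0 x hx
      have h2 := abs_l1Norm_sub_half_le x hx
      rw [pow_zero, Nat.cast_one, div_one, ← hd] at h1
      rw [← hd] at h2
      calc |MvPolynomial.eval x (A 0) - d / 2|
          ≤ |MvPolynomial.eval x (A 0) - (∑ i, |x i|)| + |(∑ i, |x i|) - d / 2| := abs_sub_le _ _ _
        _ ≤ d * π + d / 2 := by rw [abs_sub_comm] at h1; exact add_le_add h1 h2
        _ = d * (1 / 2 + π) := by ring
    | succ l =>
      rw [hA's, hRs]
      have h1 := hAerr (l + 1) x hx
      have h2 := hAerr l x hx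
      rw [← hd] at h1 h2
      calc |MvPolynomial.eval x (A (l + 1)) - MvPolynomial.eval x (A l)|
          ≤ |MvPolynomial.eval x (A (l + 1)) - (∑ i, |x i|)| + |(∑ i, |x i|) - MvPolynomial.eval x (A l)| := abs_sub_le _ _ _
        _ ≤ d * (π / (2 ^ (l + 1) : ℕ)) + d * (π / (2 ^ l : ℕ)) := by rw [abs_sub_comm] at h1; exact add_le_add h1 h2
        _ = 3 * d * π / 2 ^ (l + 1) := by push_cast; rw [pow_succ]; field_simp; ring
  refine ⟨A J, ?_, fun x hx => ?_, fun ω hω => ?_⟩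
  · have := hAmass J; rw [← hd] at this; push_cast at this; exact this
  · have := hAerr J x hx
    rw [← hd] at this; push_cast at this
    calc |(∑ i, |x i|) - MvPolynomial.eval x (A J)| ≤ d * (π / 2 ^ J) := this
      _ = d * π / 2 ^ J := by ring
  -- the frequency-dependent part: Taylor orders, the ladder, its mass
  set a : ℝ := ω * d with ha
  have ha0 : 0 ≤ a := mul_nonneg hω hd0
  obtain ⟨n, hn⟩ : ∃ n : ℕ → ℕ, ∀ l, n l = ⌈Real.exp 2 * (ω * R l)⌉₊ + h := ⟨fun l => ⌈Real.exp 2 * (ω * R l)⌉₊ + h, fun l => rfl⟩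
  have hnl : ∀ l, l < J + 1 → 1 ≤ n l ∧ Real.exp 2 * (ω * R l) ≤ n l := by
    intro l _
    rw [hn]
    refine ⟨hh.trans (Nat.le_add_left h _), ?_⟩
    push_cast
    exact (Nat.le_ceil _).trans (le_add_of_nonneg_right (Nat.cast_nonneg _))
  have hηl : ∀ l, Real.exp (ω * R l - n l) ≤ Real.exp (-(h : ℝ)) := by
    intro l
    refine Real.exp_le_exp.2 ?_
    rw [hn]; push_cast
    have h1 : ω * R l ≤ Real.exp 2 * (ω * R l) := by
      have : (1 : ℝ) ≤ Real.exp 2 := Real.one_le_exp (by norm_num)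
      nlinarith [mul_nonneg hω (hR0 l)]
    have h2 := Nat.le_ceil (Real.exp 2 * (ω * R l))
    linarith
  have hηsum : ∑ l ∈ range (J + 1), Real.exp (ω * R l - n l) ≤ ((J : ℝ) + 1) * Real.exp (-(h : ℝ)) := by
    calc ∑ l ∈ range (J + 1), Real.exp (ω * R l - n l) ≤ ∑ _l ∈ range (J + 1), Real.exp (-(h : ℝ)) :=
          Finset.sum_le_sum fun l _ => hηl l
      _ = ((J : ℝ) + 1) * Real.exp (-(h : ℝ)) := by rw [sum_const, card_range, nsmul_eq_mul]; push_cast; ring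
  -- the Taylor ladder with mass
  obtain ⟨Cr, Ci, hCr, hCi, happ⟩ :=
    exists_pair_near_cexp_sum_taylor_mass (ι := ι) (ω * (d / 2)) hω B mB R n (J + 1) hmassB hBR hnl (hηsum.trans hJh)
  -- the mass of the ladder: `∏_{l≤J} 2(1 + ω m_B(l))^{n_l − 1} ≤ exp Λ`
  set Λ : ℝ := ((J : ℝ) + 1) * Real.log 2 + (6 * π * Real.exp 2 * a + h * ((J : ℝ) + 1)) * Real.log (1 + 10 * a) +
    (3 * π * Real.exp 2 * a * ((J : ℝ) + 1) + h * (2 ^ (J + 1) - 1)) * Real.log 81 with hΛ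
  have hν : ∀ l, ((n l - 1 : ℕ) : ℝ) ≤ 3 * π * Real.exp 2 * a / 2 ^ l + h := by
    intro l
    have hn1 : 1 ≤ n l := by rw [hn]; exact hh.trans (Nat.le_add_left h _)
    rw [Nat.cast_sub hn1, hn]; push_cast
    have hceil : (⌈Real.exp 2 * (ω * R l)⌉₊ : ℝ) < Real.exp 2 * (ω * R l) + 1 :=
      Nat.ceil_lt_add_one (mul_nonneg (Real.exp_pos _).le (mul_nonneg hω (hR0 l)))
    have hωR : ω * R l ≤ 3 * π * a / 2 ^ l := by
      cases l with
      | zero => rw [hR0', pow_zero, div_one, ha]; nlinarith [mul_nonneg hω hd0]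
      | succ l => rw [hRs, ha]; exact le_of_eq (by ring)
    have he0 : 0 ≤ Real.exp 2 := (Real.exp_pos 2).le
    have hT : Real.exp 2 * (ω * R l) ≤ 3 * π * Real.exp 2 * a / 2 ^ l :=
      calc Real.exp 2 * (ω * R l) ≤ Real.exp 2 * (3 * π * a / 2 ^ l) := mul_le_mul_of_nonneg_left hωR he0
        _ = 3 * π * Real.exp 2 * a / 2 ^ l := by ring
    linarith [hceil, hT]
  have hX1 : ∀ l, 1 + ω * mB l ≤ (1 + 10 * a) * 81 ^ (2 ^ l) := by
    intro l
    have h81 : (1 : ℝ) ≤ 81 ^ (2 ^ l) := one_le_pow₀ (by norm_num)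
    cases l with
    | zero => rw [hmB0]; nlinarith [ha0]
    | succ l =>
      rw [hmBs]
      have h29 : (2 : ℝ) ^ (l + 1) * 9 ^ (2 ^ (l + 1)) ≤ 81 ^ (2 ^ (l + 1)) := by
        rw [show (81 : ℝ) = 9 * 9 by norm_num, mul_pow]
        refine mul_le_mul_of_nonneg_right ?_ (by positivity)
        calc (2 : ℝ) ^ (l + 1) ≤ 9 ^ (l + 1) := pow_le_pow_left₀ zero_le_two (by norm_num) _
          _ ≤ 9 ^ (2 ^ (l + 1)) := pow_le_pow_right₀ (by norm_num) (Nat.lt_two_pow_self).le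
      have h1 := mul_le_mul_of_nonneg_left h29 (by positivity : (0 : ℝ) ≤ 2 * a)
      have h81' : (1 : ℝ) ≤ 81 ^ (2 ^ (l + 1)) := one_le_pow₀ (by norm_num)
      have e : ω * (2 * d * (2 ^ (l + 1) * 9 ^ 2 ^ (l + 1))) = 2 * a * (2 ^ (l + 1) * 9 ^ 2 ^ (l + 1)) := by rw [ha]; ring
      rw [e]
      nlinarith [ha0, h81']
  have hfac : ∀ l ∈ range (J + 1), 2 * (1 + ω * mB l) ^ (n l - 1) ≤
      Real.exp (Real.log 2 + (3 * π * Real.exp 2 * a / 2 ^ l + h) * (Real.log (1 + 10 * a) + 2 ^ l * Real.log 81)) := by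
    intro l hl
    have hmB0' : 0 ≤ ω * mB l :=
      mul_nonneg hω ((Finset.sum_nonneg fun s _ => abs_nonneg _).trans (hmassB l (mem_range.1 hl)))
    exact level_mass_le ha0 hmB0' (hX1 l) (hν l)
  have hpos : ∀ l ∈ range (J + 1), 0 ≤ 2 * (1 + ω * mB l) ^ (n l - 1) := by
    intro l hl
    have hmB0' : 0 ≤ ω * mB l :=
      mul_nonneg hω ((Finset.sum_nonneg fun s _ => abs_nonneg _).trans (hmassB l (mem_range.1 hl)))
    positivity
  have hsum_exp : ∑ l ∈ range (J + 1), (Real.log 2 + (3 * π * Real.exp 2 * a / 2 ^ l + h) * (Real.log (1 + 10 * a) + 2 ^ l * Real.log 81)) ≤ Λ := by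
    have hsplit : ∀ l : ℕ, Real.log 2 + (3 * π * Real.exp 2 * a / 2 ^ l + h) * (Real.log (1 + 10 * a) + 2 ^ l * Real.log 81) =
        Real.log 2 + (3 * π * Real.exp 2 * a * Real.log (1 + 10 * a)) * (1 / 2 ^ l) + h * Real.log (1 + 10 * a) +
          3 * π * Real.exp 2 * a * Real.log 81 + (h * Real.log 81) * 2 ^ l := by
      intro l
      have h2 : (2 : ℝ) ^ l ≠ 0 := pow_ne_zero _ two_ne_zero
      field_simp
      ring
    simp only [hsplit, Finset.sum_add_distrib, Finset.sum_const, card_range, nsmul_eq_mul, ← Finset.mul_sum]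
    have hgeo1 : ∑ l ∈ range (J + 1), (1 : ℝ) / 2 ^ l ≤ 2 := by
      have e : ∀ l : ℕ, (1 : ℝ) / 2 ^ l = (1 / 2) ^ l := fun l => by rw [one_div, one_div, inv_pow]
      simp only [e]
      have := geom_sum_eq (x := (1 / 2 : ℝ)) (by norm_num) (J + 1)
      rw [this]
      have hp : (0 : ℝ) < (1 / 2) ^ (J + 1) := by positivity
      have : ((1 / 2 : ℝ) ^ (J + 1) - 1) / (1 / 2 - 1) = 2 * (1 - (1 / 2) ^ (J + 1)) := by field_simp; ring
      rw [this]; nlinarith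
    have hgeo2 : ∑ l ∈ range (J + 1), (2 : ℝ) ^ l = 2 ^ (J + 1) - 1 := by
      have := geom_sum_eq (x := (2 : ℝ)) (by norm_num) (J + 1)
      rw [this]; ring
    rw [hgeo2]
    have hc0 : 0 ≤ 3 * π * Real.exp 2 * a * Real.log (1 + 10 * a) :=
      mul_nonneg (by positivity) (Real.log_nonneg (by linarith))
    have := mul_le_mul_of_nonneg_left hgeo1 hc0
    rw [hΛ]; push_cast
    nlinarith [this]
  have hmass_tot : ∏ l ∈ range (J + 1), 2 * (1 + ω * mB l) ^ (n l - 1) ≤ Real.exp Λ := by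
    calc ∏ l ∈ range (J + 1), 2 * (1 + ω * mB l) ^ (n l - 1)
        ≤ ∏ l ∈ range (J + 1), Real.exp (Real.log 2 + (3 * π * Real.exp 2 * a / 2 ^ l + h) *
            (Real.log (1 + 10 * a) + 2 ^ l * Real.log 81)) := Finset.prod_le_prod hpos hfac
      _ = Real.exp (∑ l ∈ range (J + 1), (Real.log 2 + (3 * π * Real.exp 2 * a / 2 ^ l + h) *
            (Real.log (1 + 10 * a) + 2 ^ l * Real.log 81))) := (Real.exp_sum _ _).symm
      _ ≤ Real.exp Λ := Real.exp_le_exp.2 hsum_exp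
  refine ⟨Cr, Ci, hCr.trans hmass_tot, hCi.trans hmass_tot, fun x hx => ?_⟩
  -- the phase telescopes to `ω·A_J(x)`
  have htel : ω * (d / 2) + ω * ∑ l ∈ range (J + 1), MvPolynomial.eval x (B l) = ω * MvPolynomial.eval x (A J) := by
    have hsumB : ∑ l ∈ range (J + 1), MvPolynomial.eval x (B l) = MvPolynomial.eval x (A J) - d / 2 := by
      have hsub : ∀ l, MvPolynomial.eval x (B l) = MvPolynomial.eval x (A l) - MvPolynomial.eval x (A' l) := fun l => by
        rw [hB, map_sub]
      simp only [hsub, Finset.sum_sub_distrib]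
      rw [Finset.sum_range_succ (fun l => MvPolynomial.eval x (A l)), Finset.sum_range_succ' (fun l => MvPolynomial.eval x (A' l))]
      have hxA'0 : MvPolynomial.eval x (A' 0) = d / 2 := by rw [hA'0, MvPolynomial.eval_C]
      have hxA's : ∀ l, MvPolynomial.eval x (A' (l + 1)) = MvPolynomial.eval x (A l) := fun l => by rw [hA's]
      simp only [hxA'0, hxA's]
      ring
    rw [hsumB]; ring
  have happ' := happ x hx
  rw [htel] at happ'
  exact happ'.trans (by nlinarith [hηsum, Real.exp_pos (-(h : ℝ))])

end Summit.QuantumFields.YangMills.Theorems.BalabanUVNodesN19LipschitzLinksMomentLadder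

end
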